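import Literature.AlgebraicGeometry.Resolution.BlowupAlgebraPresentation
import Mathlib.RingTheory.RegularLocalRing.Polynomial
import Mathlib.RingTheory.Polynomial.Basic
import HarnessLib

/-!
# The chart `S[I/x_i] ⊆ K` of the blow-up of a subring of a field along a quasi-regular sequence:
# the exceptional fibre `S[I/x_i]/(x_i) ≅ (S/I)[T_j : j ≠ i]`

For a subring `S` of a field `K`, a QUASI-REGULAR sequence `x_1, …, x_r ∈ S` (`IsQuasiRegular`, e.g. part of a
regular system of parameters of a regular local ring) with `x_i ≠ 0`, and `I = (x_1, …, x_r)`, the chart ring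
`S[I/x_i] := S[x_j/x_i : j] ⊆ K` (`Subring.closure (S ∪ {x_j/x_i})`, the ring whose localisation at the centre of a
valuation is the local blowing up along `I`, `LocalBlowup.lean` / NSp Def. 2.11) satisfies

* `closure_chartQuotient` — `S[I/x_i]/(x_i) ≅ (S/I)[T_j : j ≠ i]` compatibly with `S → S[I/x_i]` (Stacks 0BIQ: the
  affine blow-up algebra of an `H₁`-regular `(a, a_2, …, a_r)` is `S[y_j]/(a y_j − a_j)`, which is `(S/I)[y_j]` modulo
  `a`; here via the tree's presentation `blowupAlgebra.comap_eval_span_algebraMap_eq` of the abstract affine blow-up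
  algebra `blowupAlgebra I x_i ⊆ S[1/x_i]` and its isomorphism onto `S[I/x_i] ⊆ K`);
* `isRegularRing_closure_quotient_span_singleton` — hence `S[I/x_i]/(x_i)` is a regular ring when `S/I` is;
* `isPrime_span_singleton_closure` — and `(x_i) ⊂ S[I/x_i]` is a prime ideal when `S/I` is a domain (the
  exceptional prime of the chart);
(so the local blowing up `(S[I/x_i])_{𝔪_O ∩ S[I/x_i]}` along a valuation ring `O` has a regular local ring at its
exceptional prime `(x_i)` — quotient and localisation commute).

The case `I = 𝔪_S` of a regular local `S` is `BlowupRingExceptionalFibre.lean` (`blowupRing_chartQuotient`), whose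
proof is followed verbatim with `𝔪_S`, `κ(S)` replaced by `I`, `S/I`. No definitions.
References: Stacks Project Tag 0BIQ (More on Algebra, Lemma 32.2) [StacksProject]; H. Matsumura, *Commutative Ring
Theory* (1986), Thm. 17.10 (quasi-regularity) [Matsumura1987]. -/

noncomputable section

open IsLocalRing

namespace Literature.AlgebraicGeometry.Resolution

universe u

variable {K : Type u} [Field K]

/-- `S ≤ S[I/x_i]`. [folklore] -/
private theorem le_closure_chart (S : Subring K) {r : ℕ} (x : Fin r → S) (i : Fin r) :
    S ≤ Subring.closure ((S : Set K) ∪ Set.range fun j => ((x j : S) : K) / ((x i : S) : K)) :=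
  fun _ hz => Subring.subset_closure (Or.inl hz)

/-- **The exceptional fibre of the chart of the blow-up along a quasi-regular sequence is an affine space over
`S/I`.** For a subring `S ⊆ K`, a quasi-regular sequence `x` in `S` with `x_i ≠ 0` and `I = (x)`:
`S[I/x_i]/(x_i) ≅ (S/I)[T_j : j ≠ i]` compatibly with `S → S[I/x_i]`, where `S[I/x_i] = S[x_j/x_i : j] ⊆ K`. The
affine blow-up algebra `blowupAlgebra I x_i ⊆ S[1/x_i]` maps isomorphically onto `S[I/x_i]` under `S[1/x_i] → K`;
modulo `x_i` its presentation `S[T_j : j ≠ i] → S[I/x_i]` has kernel `I · S[T]`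
(`blowupAlgebra.comap_eval_span_algebraMap_eq`, quasi-regularity), the kernel of `S[T] → (S/I)[T]`.
[cite: StacksProject, Tag 0BIQ] -/
theorem closure_chartQuotient (S : Subring K) {r : ℕ} (x : Fin r → S) (hqr : IsQuasiRegular x) (i : Fin r)
    (hxi : x i ≠ 0) :
    ∃ ψ : MvPolynomial {j : Fin r // j ≠ i} (S ⧸ Ideal.span (Set.range x)) →+*
        Subring.closure ((S : Set K) ∪ Set.range fun j => ((x j : S) : K) / ((x i : S) : K)) ⧸
          Ideal.span {(⟨(x i : K), le_closure_chart S x i (x i).2⟩ :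
            Subring.closure ((S : Set K) ∪ Set.range fun j => ((x j : S) : K) / ((x i : S) : K)))},
      Function.Bijective ψ ∧
      ∀ s : S, ψ (MvPolynomial.C (Ideal.Quotient.mk _ s)) =
        Ideal.Quotient.mk _ ⟨(s : K), le_closure_chart S x i s.2⟩ := by
  -- adapted from `blowupRing_chartQuotient` (BlowupRingExceptionalFibre.lean), `𝔪_S ↦ I`, `κ(S) ↦ S/I`
  classical
  set C := Subring.closure ((S : Set K) ∪ Set.range fun j => ((x j : S) : K) / ((x i : S) : K)) with hCdef
  have hSC : S ≤ C := le_closure_chart S x i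
  have hθ : ((x i : S) : K) ≠ 0 := fun h => hxi (Subtype.ext h)
  have hunit : IsUnit (S.subtype (x i)) := isUnit_iff_ne_zero.mpr hθ
  -- `Θ : S[1/x_i] → K` and `g : blowupAlgebra → K`
  let Θ : Localization.Away (x i) →+* K := IsLocalization.Away.lift (x i) hunit
  have hΘalg : ∀ s : S, Θ (algebraMap S (Localization.Away (x i)) s) = (s : K) := fun s =>
    IsLocalization.Away.lift_eq (x i) hunit s
  have hΘinv : Θ (IsLocalization.Away.invSelf (x i)) = ((x i : S) : K)⁻¹ := by
    apply eq_inv_of_mul_eq_one_left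
    rw [← hΘalg (x i), ← map_mul, mul_comm, IsLocalization.Away.mul_invSelf, map_one]
  let g : blowupAlgebra (Ideal.span (Set.range x)) (x i) →+* K :=
    Θ.comp (blowupAlgebra (Ideal.span (Set.range x)) (x i)).val.toRingHom
  have hgalg : ∀ s : S, g (algebraMap S (blowupAlgebra (Ideal.span (Set.range x)) (x i)) s) = (s : K) :=
    fun s => hΘalg s
  have hgfrac : ∀ j : Fin r, g (blowupAlgebra.frac x i j) = ((x j : S) : K) / ((x i : S) : K) := by
    intro j
    change Θ ((blowupAlgebra.frac x i j : Localization.Away (x i))) = _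
    rw [blowupAlgebra.coe_frac, map_mul, hΘalg, hΘinv, div_eq_mul_inv]
  -- `g ∘ eval = eval₂ (x_j/x_i)`
  have hgeval : g.comp (blowupAlgebra.eval x i).toRingHom =
      MvPolynomial.eval₂Hom S.subtype
        (fun j : {j : Fin r // j ≠ i} => ((x j.1 : S) : K) / ((x i : S) : K)) := by
    refine (blowupAlgebra.comp_val_comp_eval x i Θ).trans ?_
    congr 1
    · ext s
      exact hΘalg s
    · funext j
      exact hgfrac j.1
  have hgeval' : ∀ P, g (blowupAlgebra.eval x i P) = MvPolynomial.eval₂Hom S.subtype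
      (fun j : {j : Fin r // j ≠ i} => ((x j.1 : S) : K) / ((x i : S) : K)) P := fun P => by
    rw [← hgeval]; rfl
  -- the range of `g` is `C`
  have heval_mem : ∀ P : MvPolynomial {j : Fin r // j ≠ i} S, MvPolynomial.eval₂Hom S.subtype
      (fun j : {j : Fin r // j ≠ i} => ((x j.1 : S) : K) / ((x i : S) : K)) P ∈ C := by
    intro P
    induction P using MvPolynomial.induction_on with
    | C s =>
      rw [MvPolynomial.eval₂Hom_C]
      exact hSC s.2
    | add p q hp hq =>
      rw [map_add]
      exact Subring.add_mem _ hp hq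
    | mul_X p j hp =>
      rw [map_mul, MvPolynomial.eval₂Hom_X']
      exact Subring.mul_mem _ hp (Subring.subset_closure (Or.inr ⟨j.1, rfl⟩))
  have hrange : g.range = C := by
    apply le_antisymm
    · rintro _ ⟨z, rfl⟩
      obtain ⟨P, rfl⟩ := blowupAlgebra.eval_surjective x i z
      rw [hgeval']
      exact heval_mem P
    · rw [hCdef, Subring.closure_le]
      rintro z (hz | ⟨j, rfl⟩)
      · exact ⟨algebraMap S _ ⟨z, hz⟩, hgalg ⟨z, hz⟩⟩
      · exact ⟨blowupAlgebra.frac x i j, hgfrac j⟩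
  -- `g` is injective
  have hΘinj : ∀ z, Θ z = 0 → z = 0 := by
    intro z hz
    obtain ⟨⟨a, b⟩, hab⟩ := IsLocalization.surj (Submonoid.powers (x i)) z
    have ha : (a : K) = 0 := by
      have h := congrArg Θ hab
      rw [map_mul, hz, zero_mul, hΘalg] at h
      exact h.symm
    have ha0 : a = 0 := Subtype.ext ha
    rw [ha0, map_zero] at hab
    exact (IsUnit.mul_left_eq_zero (IsLocalization.map_units _ b)).mp hab
  have hginj : Function.Injective g := by
    intro a b h
    apply Subtype.ext
    have h0 : Θ ((a : Localization.Away (x i)) - b) = 0 := by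
      rw [map_sub]
      exact sub_eq_zero.mpr h
    exact sub_eq_zero.mp (hΘinj _ h0)
  -- `e₁ : blowupAlgebra ≃ C`
  have hmem : ∀ b, g b ∈ C := fun b => by rw [← hrange]; exact ⟨b, rfl⟩
  let g' : blowupAlgebra (Ideal.span (Set.range x)) (x i) →+* C := g.codRestrict _ hmem
  have hg' : Function.Bijective g' := by
    refine ⟨fun a b h => hginj (congrArg Subtype.val h), fun z => ?_⟩
    have hz : (z : K) ∈ g.range := by rw [hrange]; exact z.2
    obtain ⟨b, hb⟩ := hz
    exact ⟨b, Subtype.ext hb⟩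
  let e₁ : blowupAlgebra (Ideal.span (Set.range x)) (x i) ≃+* C := RingEquiv.ofBijective g' hg'
  have he₁alg : ∀ s : S, e₁ (algebraMap S (blowupAlgebra (Ideal.span (Set.range x)) (x i)) s) =
      ⟨(s : K), hSC s.2⟩ := fun s => Subtype.ext (hgalg s)
  -- the presentation modulo `x_i`: `S[T] → blowupAlgebra/(x_i)` is onto with kernel `I · S[T]`
  let J : Ideal (blowupAlgebra (Ideal.span (Set.range x)) (x i)) :=
    Ideal.span {algebraMap S (blowupAlgebra (Ideal.span (Set.range x)) (x i)) (x i)}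
  let π : MvPolynomial {j : Fin r // j ≠ i} S →+* blowupAlgebra (Ideal.span (Set.range x)) (x i) ⧸ J :=
    (Ideal.Quotient.mk J).comp (blowupAlgebra.eval x i).toRingHom
  have hπsurj : Function.Surjective π :=
    Ideal.Quotient.mk_surjective.comp (blowupAlgebra.eval_surjective x i)
  have hπker : RingHom.ker π = Ideal.map MvPolynomial.C (Ideal.span (Set.range x)) := by
    change RingHom.ker ((Ideal.Quotient.mk J).comp _) = _
    rw [← RingHom.comap_ker, Ideal.mk_ker]
    exact blowupAlgebra.comap_eval_span_algebraMap_eq x i hqr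
  -- `S[T] → (S/I)[T]` is onto with the same kernel
  let σ : MvPolynomial {j : Fin r // j ≠ i} S →+*
      MvPolynomial {j : Fin r // j ≠ i} (S ⧸ Ideal.span (Set.range x)) :=
    MvPolynomial.map (Ideal.Quotient.mk (Ideal.span (Set.range x)))
  have hσsurj : Function.Surjective σ := MvPolynomial.map_surjective _ Ideal.Quotient.mk_surjective
  have hσker : RingHom.ker σ = Ideal.map MvPolynomial.C (Ideal.span (Set.range x)) := by
    change RingHom.ker (MvPolynomial.map (Ideal.Quotient.mk (Ideal.span (Set.range x)))) = _
    rw [MvPolynomial.ker_map, Ideal.mk_ker]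
  -- hence `ψ' : (S/I)[T] → blowupAlgebra/(x_i)`, a bijection
  let ψ' : MvPolynomial {j : Fin r // j ≠ i} (S ⧸ Ideal.span (Set.range x)) →+*
      blowupAlgebra (Ideal.span (Set.range x)) (x i) ⧸ J :=
    σ.liftOfSurjective hσsurj ⟨π, by rw [hσker, hπker]⟩
  have hψ'σ : ∀ P, ψ' (σ P) = π P := fun P =>
    σ.liftOfSurjective_comp_apply hσsurj ⟨π, by rw [hσker, hπker]⟩ P
  have hψ'bij : Function.Bijective ψ' := by
    constructor
    · refine (injective_iff_map_eq_zero ψ').mpr fun Q hQ => ?_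
      obtain ⟨P, rfl⟩ := hσsurj Q
      rw [hψ'σ] at hQ
      have hP : P ∈ RingHom.ker σ := by rw [hσker, ← hπker]; exact hQ
      exact hP
    · intro z
      obtain ⟨P, rfl⟩ := hπsurj z
      exact ⟨σ P, hψ'σ P⟩
  -- transport along `e₁`
  let J' : Ideal C := Ideal.span {(⟨(x i : K), hSC (x i).2⟩ : C)}
  have hJJ' : J' = J.map (e₁ : blowupAlgebra (Ideal.span (Set.range x)) (x i) →+* C) := by
    change Ideal.span _ = Ideal.map _ (Ideal.span _)
    rw [Ideal.map_span, Set.image_singleton]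
    congr 2
    exact (he₁alg (x i)).symm
  let q : blowupAlgebra (Ideal.span (Set.range x)) (x i) ⧸ J ≃+* C ⧸ J' :=
    Ideal.quotientEquiv J J' e₁ hJJ'
  refine ⟨q.toRingHom.comp ψ', q.bijective.comp hψ'bij, fun s => ?_⟩
  -- constants: `C s̄ ↦ [s/1] ↦ [s]`
  have hσC : σ (MvPolynomial.C s) = MvPolynomial.C (Ideal.Quotient.mk _ s) := MvPolynomial.map_C _ _
  change q (ψ' (MvPolynomial.C (Ideal.Quotient.mk _ s))) = _
  rw [← hσC, hψ'σ]
  change q (Ideal.Quotient.mk J ((blowupAlgebra.eval x i) (MvPolynomial.C s))) = _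
  rw [blowupAlgebra.eval_C, Ideal.quotientEquiv_mk]
  congr 1
  exact he₁alg s

/-- **`S[I/x_i]/(x_i)` is a regular ring when `S/I` is** (a polynomial ring over `S/I`, `closure_chartQuotient`;
Mathlib `MvPolynomial.isRegularRing_of_isRegularRing`). [cite: StacksProject, Tag 0BIQ] -/
theorem isRegularRing_closure_quotient_span_singleton (S : Subring K) {r : ℕ} (x : Fin r → S)
    (hqr : IsQuasiRegular x) (i : Fin r) (hxi : x i ≠ 0)
    [IsRegularRing (S ⧸ Ideal.span (Set.range x))] :
    IsRegularRing (Subring.closure ((S : Set K) ∪ Set.range fun j => ((x j : S) : K) / ((x i : S) : K)) ⧸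
      Ideal.span {(⟨(x i : K), le_closure_chart S x i (x i).2⟩ :
        Subring.closure ((S : Set K) ∪ Set.range fun j => ((x j : S) : K) / ((x i : S) : K)))}) := by
  obtain ⟨ψ, hψ, -⟩ := closure_chartQuotient S x hqr i hxi
  haveI : IsRegularRing (MvPolynomial {j : Fin r // j ≠ i} (S ⧸ Ideal.span (Set.range x))) :=
    inferInstance
  exact IsRegularRing.of_ringEquiv
    (R := MvPolynomial {j : Fin r // j ≠ i} (S ⧸ Ideal.span (Set.range x))) (RingEquiv.ofBijective ψ hψ)

/-- **The exceptional prime `(x_i) ⊂ S[I/x_i]`**: for `I = (x)` prime, i.e. `S/I` a domain, the principal ideal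
`(x_i)` of the chart ring is prime (quotient `≅ (S/I)[T]`, a domain). [cite: StacksProject, Tag 0BIQ] -/
theorem isPrime_span_singleton_closure (S : Subring K) {r : ℕ} (x : Fin r → S)
    (hqr : IsQuasiRegular x) (i : Fin r) (hxi : x i ≠ 0) [IsDomain (S ⧸ Ideal.span (Set.range x))] :
    (Ideal.span {(⟨(x i : K), le_closure_chart S x i (x i).2⟩ :
      Subring.closure ((S : Set K) ∪ Set.range fun j => ((x j : S) : K) / ((x i : S) : K)))}).IsPrime := by
  obtain ⟨ψ, hψ, -⟩ := closure_chartQuotient S x hqr i hxi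
  rw [← Ideal.Quotient.isDomain_iff_prime]
  exact MulEquiv.isDomain _ (RingEquiv.ofBijective ψ hψ).symm.toMulEquiv

end Literature.AlgebraicGeometry.Resolution

end
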